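import Mathlib.RepresentationTheory.Homological.Resolution
import HarnessLib

/-!
# The augmentation of Mathlib's bar resolution on generators: `ε_bar [x] = 1`

Topic `Algebra/Homology`; namespace `Literature.Algebra.Homology.RepExt`.  Theorems only; no
definition, no named fact, no instance, no `sorry`.

Two explicit formulas that Mathlib proves only inside other proofs:
* `diagonalSuccIsoFree_inv_single_single`: the inverse of Mathlib's `Rep.diagonalSuccIsoFree k G m :
  k[Gᵐ⁺¹] ≅ (Gᵐ →₀ k[G])` sends `single f (single g r)` to `single (g • Fin.partialProd f) r`
  (`(g, g f₀, g f₀ f₁, …)`; the `have H` inside Mathlib's `barComplex.d_comp_diagonalSuccIsoFree_inv_eq`);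
* **`barResolution_π_f_zero_single`**: the augmentation `(Rep.barResolution k G).π` in degree `0`
  takes the value `1` on every generator `single x (single 1 1)` of `k[G] = free k G (Fin 0 → G)`.

Written for Route A of crux `stmt-BirchSwinnertonDyer-19295` (cell `bsd-schneider-ideate`, seat
door-c4 gen 14): it is the normalisation needed to compute the dictionary
`RepExt.extTrivialAddEquivGroupCohomology : Extⁿ_{Rep k G}(k, A) ≃+ Hⁿ(G, A)` in degree `0`
(`E(mk₀ a) ↦ a(1)`), the base case of its change-of-group compatibility.
HONEST FRAMING: bookkeeping about Mathlib's bar resolution only.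

## References
* K. S. Brown, *Cohomology of Groups*, GTM 87 (1982), I §5 (the bar resolution and its augmentation).
  [Brown1982CohomologyGroups]
-/

noncomputable section

open CategoryTheory Rep
open scoped MonoidAlgebra

universe u

namespace Literature.Algebra.Homology

namespace RepExt

variable (k G : Type u) [CommRing k] [Group G]

set_option backward.isDefEq.respectTransparency false in
/-- **`(diagonalSuccIsoFree k G m)⁻¹ (single f (single g r)) = single (g • Fin.partialProd f) r`**
(Mathlib's description of the inverse, `(g₀, …, gₘ) ↤ g₀ ⊗ (g₁, …, gₘ)` with partial products).
[cite: Brown1982CohomologyGroups, I §5] -/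
theorem diagonalSuccIsoFree_inv_single_single (m : ℕ) (f : Fin m → G) (g : G) (r : k) :
    (diagonalSuccIsoFree k G m).inv.hom (Finsupp.single f (MonoidAlgebra.single g r)) =
      MonoidAlgebra.single (g • Fin.partialProd f) r := by
  -- adapted from the `have H` block in Mathlib's `Rep.barComplex.d_comp_diagonalSuccIsoFree_inv_eq`
  simp only [diagonalSuccIsoFree, diagonalSuccIsoTensorTrivial, Iso.trans_inv, Rep.hom_comp,
    Representation.IntertwiningMap.comp_apply]
  have step1 : (Hom.hom (leftRegularTensorTrivialIsoFree k G (Fin m → G)).inv)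
      (Finsupp.single f (.single g r)) = .single g 1 ⊗ₜ[k] .single f r :=
    Representation.leftRegularTensorTrivialIsoFree_symm_apply_single_single f g r
  rw [step1]
  simp only [mkIso_inv, Representation.linearizeOfMulActionIso, Representation.Equiv.mk_symm,
    LinearEquiv.refl_symm, ConcreteCategory.hom_ofHom, Action.tensorObj_V,
    Functor.mapIso_inv, tensor_V, tensor_ρ, Iso.symm_inv, Functor.Monoidal.μIso_hom, μ_hom,
    MonoidalCategory.tensorIso_inv, Representation.linearizeTrivialIso, hom_tensorHom,
    Representation.IntertwiningMap.tensor_apply, Representation.Equiv.coe_toIntertwiningMap,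
    Representation.Equiv.mk_apply, LinearEquiv.refl_apply]
  have key₁ := Representation.linearizeMap_single (k := k)
    (Action.diagonalSuccIsoTensorTrivial G m).inv (g, f) ((1 : k) * r)
  have key₂ := Representation.LinearizeMonoidal.μ_apply_single_single (k := k)
    (X := Action.leftRegular G) (Y := Action.trivial G (Fin m → G)) g f 1 r
  refine ((congrArg (fun z => (Representation.linearizeMap
    (Action.diagonalSuccIsoTensorTrivial G m).inv) z) key₂).trans key₁).trans ?_
  rw [one_mul]
  exact congrArg (MonoidAlgebra.single · r) (Action.diagonalSuccIsoTensorTrivial_inv_hom_apply g f)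

/-- The augmentation of the bar resolution in degree `0` is `(diagonalSuccIsoFree k G 0)⁻¹ ≫ ε`
(definitional unfolding of `Rep.barResolution`). [cite: Brown1982CohomologyGroups, I §5] -/
theorem barResolution_π_f_zero :
    (Rep.barResolution k G).π.f 0 = (diagonalSuccIsoFree k G 0).inv ≫ standardComplex.ε k G := by
  change ((barComplex.isoStandardComplex k G).hom ≫ standardComplex.εToSingle₀ k G).f 0 = _
  rw [HomologicalComplex.comp_f]
  rfl

/-- **`ε_bar (single x (single 1 1)) = 1`**: the augmentation of Mathlib's bar resolution takes the
value `1` on the generators of `k[G] = free k G (Fin 0 → G)`. [cite: Brown1982CohomologyGroups, I §5] -/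
theorem barResolution_π_f_zero_single (x : Fin 0 → G) :
    ((Rep.barResolution k G).π.f 0).hom (Finsupp.single x (MonoidAlgebra.single (1 : G) (1 : k))) = (1 : k) := by
  have h2 : ((diagonalSuccIsoFree k G 0).inv ≫ standardComplex.ε k G).hom
      (Finsupp.single x (MonoidAlgebra.single (1 : G) (1 : k))) = (1 : k) := by
    rw [Rep.hom_comp, Representation.IntertwiningMap.comp_apply,
      diagonalSuccIsoFree_inv_single_single, one_smul]
    simp [standardComplex.ε]
  rw [barResolution_π_f_zero]
  exact h2

end RepExt

end Literature.Algebra.Homology
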